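import Literature.NumberTheory.Automorphic.BigBruhatCellChart
import Mathlib.Analysis.Calculus.ContDiff.Operations
import Mathlib.Analysis.Calculus.InverseFunctionTheorem.FDeriv
import Mathlib.Analysis.Calculus.Deriv.Mul
import Mathlib.Analysis.Matrix.Normed
import Mathlib.Analysis.Normed.Ring.Units
import Mathlib.Topology.Algebra.Module.FiniteDimension
import HarnessLib

/-!
# The big Bruhat cell of `GL_n(R)` over a finite-dimensional real algebra: smoothness of the chart and
# of its inverse

Topic `NumberTheory/Automorphic`; namespace `Literature.NumberTheory.Automorphic`. Analytic half of
`BigBruhatCellChart` for `R` a complete normed commutative real algebra of finite dimension (the case of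
interest is `R = K_∞ = K ⊗_ℚ ℝ`): the chart

  `Ψ : 𝔫 × Rⁿ × 𝔫 → M_n(R)`, `Ψ(X₁, a, X₂) = (1 + X₁) w⁰ diag(a) (1 + X₂)` (`cellChart`)

is smooth (`contDiff_cellChart`), its derivative at a point with unit `a`,
`dΨ(Y₁, H, Y₂) = Y₁ w⁰ D (1 + X₂) + (1 + X₁) w⁰ diag(H) (1 + X₂) + (1 + X₁) w⁰ D Y₂` (`fderiv_cellChart_apply`),
is a linear isomorphism onto `M_n(R)` (`cellChartDerivEquiv`: injective because
`M_n = 𝔫⁻ ⊕ 𝔡 ⊕ 𝔫` after multiplying by `((1 + X₁) w⁰)⁻¹` and `(1 + X₂)⁻¹`, surjective by the explicit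
triangular decomposition), so by the inverse function theorem `Ψ` restricted to the open set
`cellSource = {a ∈ (Rˣ)ⁿ}` is an open embedding (`cellChartHomeo : OpenPartialHomeomorph`) — injective by
`bigCellMap_injective` — whose inverse is smooth on the open image, the **big cell**
`bruhatBigCell = Ψ(cellSource)` (`contDiffAt_cellChart_symm`, `contDiffOn_cellChart_symm`).

Everything is proved; no named fact is introduced.

## References

* J. A. Shalika, *The multiplicity one theorem for `GL_n`*, Ann. of Math. 100 (1974), §2 [Shalika1974].
* D. Bump, *Automorphic Forms and Representations* (1997), §4.4 [Bump1997].
-/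

noncomputable section

open Matrix Set Filter Topology Function
open scoped Matrix.Norms.Operator ContDiff

namespace Literature.NumberTheory.Automorphic

variable {n : ℕ} {R : Type*}

local notation "Mat" => Matrix (Fin n) (Fin n) R

/-! ### 0. Triangular decomposition `M_n = 𝔫⁻ ⊕ 𝔡 ⊕ 𝔫` (pure algebra) -/

section AlgebraAux

variable [CommRing R]

/-- Strictly lower matrices: `M i j = 0` for `i ≤ j`. [folklore] -/
def IsStrictLower (M : Mat) : Prop := ∀ i j : Fin n, i ≤ j → M i j = 0

/-- `w⁰ M w⁰` is strictly lower for strictly upper `M`. [folklore] -/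
theorem isStrictLower_weylLong_conj {M : Mat} (hM : M ∈ strictUpper n R) :
    IsStrictLower (((weylLong n R : GL (Fin n) R) : Mat) * M * ((weylLong n R : GL (Fin n) R) : Mat)) :=
  fun i j hij => by rw [weylLong_conj_apply]; exact hM _ _ (Fin.rev_le_rev.2 hij)

/-- Strictly lower times diagonal is strictly lower. [folklore] -/
theorem IsStrictLower.mul_diagonal {M : Mat} (hM : IsStrictLower M) (d : Fin n → R) : IsStrictLower (M * diagonal d) :=
  fun i j hij => by rw [Matrix.mul_diagonal, hM i j hij, zero_mul]

/-- Diagonal times strictly upper is strictly upper. [folklore] -/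
theorem diagonal_mul_mem_strictUpper {M : Mat} (hM : M ∈ strictUpper n R) (d : Fin n → R) :
    diagonal d * M ∈ strictUpper n R :=
  fun i j hij => by rw [Matrix.diagonal_mul, hM i j hij, mul_zero]

/-- **`M_n = 𝔫⁻ ⊕ 𝔡 ⊕ 𝔫`**: if `A + diag h + C = 0` with `A` strictly lower and `C` strictly upper then
`A = 0`, `h = 0`, `C = 0`. [folklore] -/
theorem triangular_decomp_eq_zero {A C : Mat} (hA : IsStrictLower A) (hC : C ∈ strictUpper n R) {h : Fin n → R}
    (hsum : A + diagonal h + C = 0) : A = 0 ∧ h = 0 ∧ C = 0 := by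
  have hent : ∀ i j : Fin n, A i j + diagonal h i j + C i j = 0 := fun i j => by
    have := congrFun (congrFun hsum i) j
    simpa only [Matrix.add_apply, Matrix.zero_apply] using this
  have hh : h = 0 := by
    funext i
    have h1 := hent i i
    rw [hA i i le_rfl, hC i i le_rfl, diagonal_apply_eq, zero_add, add_zero] at h1
    exact h1
  refine ⟨?_, hh, ?_⟩
  · ext i j
    rcases le_or_gt i j with hij | hij
    · exact hA i j hij
    · have h1 := hent i j
      rwa [hC i j hij.le, diagonal_apply_ne _ (ne_of_gt hij), add_zero, add_zero] at h1
  · ext i j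
    rcases le_or_gt j i with hij | hij
    · exact hC i j hij
    · have h1 := hent i j
      rwa [hA i j hij.le, diagonal_apply_ne _ (ne_of_lt hij), zero_add, zero_add] at h1

end AlgebraAux

variable [NormedCommRing R] [NormedAlgebra ℝ R]

/-! ### 1. The parameter space `𝔫 × Rⁿ × 𝔫` and the chart -/

variable (n R) in
/-- `𝔫` as a real subspace of `M_n(R)`. [folklore] -/
def strictUpperReal : Submodule ℝ (Matrix (Fin n) (Fin n) R) := (strictUpper n R).restrictScalars ℝ

/-- Membership in `strictUpperReal`. [folklore] -/
@[simp] theorem mem_strictUpperReal {X : Mat} : X ∈ strictUpperReal n R ↔ X ∈ strictUpper n R := Iff.rfl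

variable (n R) in
/-- **The parameter space `𝔫 × Rⁿ × 𝔫` of the big cell.** [folklore] -/
abbrev CellParam : Type _ := ↥(strictUpperReal n R) × (Fin n → R) × ↥(strictUpperReal n R)

/-- **The chart `Ψ(X₁, a, X₂) = (1 + X₁) w⁰ diag(a) (1 + X₂)`** on the parameter space. [folklore] -/
def cellChart (e : CellParam n R) : Mat := bigCellMap (e.1 : Mat) e.2.1 (e.2.2 : Mat)

/-- Unfolding `cellChart`. [folklore] -/
theorem cellChart_apply (e : CellParam n R) :
    cellChart e = (1 + (e.1 : Mat)) * ((weylLong n R : GL (Fin n) R) : Mat) * diagonal e.2.1 * (1 + (e.2.2 : Mat)) := rfl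

variable (n R) in
/-- **The source of the chart**: unit torus coordinates. [folklore] -/
def cellSource : Set (CellParam n R) := {e | ∀ i, IsUnit (e.2.1 i)}

/-- `cellSource` is open (units are open in a complete normed ring). [folklore] -/
theorem isOpen_cellSource [CompleteSpace R] : IsOpen (cellSource n R) := by
  have h : cellSource n R = ⋂ i : Fin n, (fun e : CellParam n R => e.2.1 i) ⁻¹' {x : R | IsUnit x} := by
    ext e; simp [cellSource]
  rw [h]
  exact isOpen_iInter_of_finite fun i =>
    Units.isOpen.preimage ((continuous_apply i).comp (continuous_fst.comp continuous_snd))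

-- as in `ArchGardingWhittaker`: the scoped `L∞`-operator normed ring structure on matrices is only
-- reducibly defeq to the Pi uniformity
set_option backward.isDefEq.respectTransparency false

/-- The diagonal as a continuous linear map `Rⁿ → M_n(R)` (real scalars). [folklore] -/
def diagonalCLM : (Fin n → R) →L[ℝ] Mat :=
  ⟨Matrix.diagonalLinearMap (Fin n) ℝ R, continuous_id.matrix_diagonal⟩

/-- `diagonalCLM a = diagonal a`. [folklore] -/
@[simp] theorem diagonalCLM_apply (a : Fin n → R) : diagonalCLM a = (diagonal a : Mat) := rfl

/-- **The chart is smooth** (a polynomial map). [folklore] -/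
theorem contDiff_cellChart : ContDiff ℝ ∞ (cellChart : CellParam n R → Mat) := by
  have h1 : ContDiff ℝ ∞ fun e : CellParam n R => (1 : Mat) + (e.1 : Mat) :=
    contDiff_const.add ((strictUpperReal n R).subtypeL.contDiff.comp contDiff_fst)
  have h2' : ContDiff ℝ ∞ fun e : CellParam n R => e.2.1 :=
    (contDiff_fst (E := Fin n → R) (F := ↥(strictUpperReal n R))).comp
      (contDiff_snd (E := ↥(strictUpperReal n R)) (F := (Fin n → R) × ↥(strictUpperReal n R)))
  have h2 : ContDiff ℝ ∞ fun e : CellParam n R => (diagonal e.2.1 : Mat) :=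
    (diagonalCLM (n := n) (R := R)).contDiff.comp h2'
  have h3 : ContDiff ℝ ∞ fun e : CellParam n R => (1 : Mat) + (e.2.2 : Mat) :=
    contDiff_const.add ((strictUpperReal n R).subtypeL.contDiff.comp (contDiff_snd.comp contDiff_snd))
  exact ((h1.mul contDiff_const).mul h2).mul h3

/-- **The derivative of the chart along a line**: `d/dt Ψ(e + t Y)|₀ =
Y₁ w⁰ D (1 + X₂) + (1 + X₁) w⁰ diag(H) (1 + X₂) + (1 + X₁) w⁰ D Y₂`. [folklore] -/
def cellChartDerivFun (e Y : CellParam n R) : Mat :=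
  (Y.1 : Mat) * ((weylLong n R : GL (Fin n) R) : Mat) * diagonal e.2.1 * (1 + (e.2.2 : Mat)) +
    (1 + (e.1 : Mat)) * ((weylLong n R : GL (Fin n) R) : Mat) * diagonal Y.2.1 * (1 + (e.2.2 : Mat)) +
    (1 + (e.1 : Mat)) * ((weylLong n R : GL (Fin n) R) : Mat) * diagonal e.2.1 * (Y.2.2 : Mat)

/-- The chart along a line `e + t Y`, as a product of affine curves. [folklore] -/
theorem cellChart_add_smul (e Y : CellParam n R) (t : ℝ) :
    cellChart (e + t • Y) =
      ((1 + (e.1 : Mat)) + t • (Y.1 : Mat)) * ((weylLong n R : GL (Fin n) R) : Mat) *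
        ((diagonal e.2.1 : Mat) + t • diagonal Y.2.1) * ((1 + (e.2.2 : Mat)) + t • (Y.2.2 : Mat)) := by
  rw [cellChart_apply]
  simp only [Prod.fst_add, Prod.snd_add, Prod.smul_fst, Prod.smul_snd, Submodule.coe_add, Submodule.coe_smul]
  rw [← diagonal_smul, diagonal_add, add_assoc, add_assoc]
  rfl

/-- Affine curves `t ↦ A + t • B` have derivative `B`. [folklore] -/
theorem hasDerivAt_const_add_smul' (A B : Mat) (t₀ : ℝ) : HasDerivAt (fun t : ℝ => A + t • B) B t₀ :=
  (((hasDerivAt_id t₀).smul_const B).const_add A).congr_deriv (one_smul ℝ B)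

/-- The line derivative of the chart. [folklore] -/
theorem hasDerivAt_cellChart_line (e Y : CellParam n R) :
    HasDerivAt (fun t : ℝ => cellChart (e + t • Y)) (cellChartDerivFun e Y) 0 := by
  set w : Mat := ((weylLong n R : GL (Fin n) R) : Mat) with hw
  have hf1 := hasDerivAt_const_add_smul' ((1 : Mat) + (e.1 : Mat)) (Y.1 : Mat) 0
  have hf2 : HasDerivAt (fun t : ℝ => ((1 + (e.1 : Mat)) + t • (Y.1 : Mat)) * w) ((Y.1 : Mat) * w) 0 :=
    hf1.mul_const w
  have hf3 := hasDerivAt_const_add_smul' (diagonal e.2.1 : Mat) (diagonal Y.2.1) 0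
  have hf4 := hasDerivAt_const_add_smul' ((1 : Mat) + (e.2.2 : Mat)) (Y.2.2 : Mat) 0
  have h := (hf2.mul hf3).mul hf4
  simp only [zero_smul, add_zero] at h
  have heq : (fun t : ℝ => cellChart (e + t • Y)) = fun t : ℝ =>
      ((1 + (e.1 : Mat)) + t • (Y.1 : Mat)) * w * ((diagonal e.2.1 : Mat) + t • diagonal Y.2.1) *
        ((1 + (e.2.2 : Mat)) + t • (Y.2.2 : Mat)) := funext fun t => by rw [cellChart_add_smul, hw]
  rw [heq]
  refine h.congr_deriv ?_
  simp only [cellChartDerivFun, ← hw, Pi.mul_apply, zero_smul, add_zero]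
  rw [Matrix.add_mul]

/-- **The Fréchet derivative of the chart** evaluated on a vector. [folklore] -/
theorem fderiv_cellChart_apply (e Y : CellParam n R) : fderiv ℝ cellChart e Y = cellChartDerivFun e Y := by
  have hd : DifferentiableAt ℝ cellChart e := contDiff_cellChart.contDiffAt.differentiableAt (by simp)
  have hγ : HasDerivAt (fun t : ℝ => e + t • Y) Y 0 := by
    simpa using ((hasDerivAt_id (0 : ℝ)).smul_const Y).const_add e
  have h1 : HasDerivAt (fun t : ℝ => cellChart (e + t • Y)) (fderiv ℝ cellChart e Y) 0 := by
    have h := (hd.hasFDerivAt.comp_hasDerivAt_of_eq (0 : ℝ) hγ (by simp))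
    exact h
  exact h1.unique (hasDerivAt_cellChart_line e Y)

/-! ### 2. The derivative is a linear isomorphism at points with unit torus coordinate -/

section Deriv

variable {e : CellParam n R}

/-- **Injectivity of the derivative** at a point with unit torus coordinate. [folklore] -/
theorem cellChartDerivFun_injective (he : e ∈ cellSource n R) : Function.Injective (cellChartDerivFun e) := by
  -- it is linear (it is `fderiv`), so it suffices to show the kernel is trivial
  have hlin : ∀ Y, cellChartDerivFun e Y = fderiv ℝ cellChart e Y := fun Y => (fderiv_cellChart_apply e Y).symm
  intro Y Y' hYY'
  have hsub : cellChartDerivFun e (Y - Y') = 0 := by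
    rw [hlin, map_sub, ← hlin, ← hlin, hYY', sub_self]
  suffices hker : ∀ Z, cellChartDerivFun e Z = 0 → Z = 0 by
    have := hker _ hsub; exact sub_eq_zero.1 this
  intro Z hZ
  obtain ⟨⟨X₁, hX₁⟩, a, ⟨X₂, hX₂⟩⟩ := e
  obtain ⟨⟨Y₁, hY₁⟩, H, ⟨Y₂, hY₂⟩⟩ := Z
  have hX₁' : X₁ ∈ strictUpper n R := hX₁
  have hX₂' : X₂ ∈ strictUpper n R := hX₂
  have hY₁' : Y₁ ∈ strictUpper n R := hY₁
  have hY₂' : Y₂ ∈ strictUpper n R := hY₂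
  have ha : ∀ i, IsUnit (a i) := he
  set w : Mat := ((weylLong n R : GL (Fin n) R) : Mat) with hw
  set S₁ : Mat := (((unitri X₁ hX₁')⁻¹ : GL (Fin n) R) : Mat) with hS₁
  set S₂ : Mat := (((unitri X₂ hX₂')⁻¹ : GL (Fin n) R) : Mat) with hS₂
  set Dinv : Mat := (((diagUnitsGL a ha)⁻¹ : GL (Fin n) R) : Mat) with hDinv
  have hS₁l : S₁ * (1 + X₁) = 1 := by
    have h := congrArg (fun g : GL (Fin n) R => (g : Mat)) (inv_mul_cancel (unitri X₁ hX₁'))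
    simpa only [Units.val_mul, coe_unitri, Units.val_one] using h
  have hS₁r : (1 + X₁) * S₁ = 1 := by
    have h := congrArg (fun g : GL (Fin n) R => (g : Mat)) (mul_inv_cancel (unitri X₁ hX₁'))
    simpa only [Units.val_mul, coe_unitri, Units.val_one] using h
  have hS₂l : S₂ * (1 + X₂) = 1 := by
    have h := congrArg (fun g : GL (Fin n) R => (g : Mat)) (inv_mul_cancel (unitri X₂ hX₂'))
    simpa only [Units.val_mul, coe_unitri, Units.val_one] using h
  have hS₂r : (1 + X₂) * S₂ = 1 := by
    have h := congrArg (fun g : GL (Fin n) R => (g : Mat)) (mul_inv_cancel (unitri X₂ hX₂'))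
    simpa only [Units.val_mul, coe_unitri, Units.val_one] using h
  have hDl : Dinv * diagonal a = 1 := by
    have h := congrArg (fun g : GL (Fin n) R => (g : Mat)) (inv_mul_cancel (diagUnitsGL a ha))
    simpa only [Units.val_mul, coe_diagUnitsGL, Units.val_one] using h
  have hDr : diagonal a * Dinv = 1 := by
    have h := congrArg (fun g : GL (Fin n) R => (g : Mat)) (mul_inv_cancel (diagUnitsGL a ha))
    simpa only [Units.val_mul, coe_diagUnitsGL, Units.val_one] using h
  have hww : w * w = 1 := weylLong_mul_weylLong
  -- `S₁` and `S₂` are upper unitriangular, hence upper triangular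
  have hS₁up : ∀ i j : Fin n, j < i → S₁ i j = 0 := fun i j hij =>
    ((mem_upperUnitriangular_iff _).1 (Subgroup.inv_mem _ (unitri_mem_upperUnitriangular X₁ hX₁'))).1 hij
  have hS₂up : ∀ i j : Fin n, j < i → S₂ i j = 0 := fun i j hij =>
    ((mem_upperUnitriangular_iff _).1 (Subgroup.inv_mem _ (unitri_mem_upperUnitriangular X₂ hX₂'))).1 hij
  -- multiply the relation by `w S₁` on the left and `S₂` on the right
  have hZ' : Y₁ * w * diagonal a * (1 + X₂) + (1 + X₁) * w * diagonal H * (1 + X₂) + (1 + X₁) * w * diagonal a * Y₂ = 0 := hZ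
  have hrel : w * (S₁ * Y₁) * w * diagonal a + diagonal H + diagonal a * (Y₂ * S₂) = 0 := by
    have h : w * S₁ * (Y₁ * w * diagonal a * (1 + X₂)) * S₂ + w * S₁ * ((1 + X₁) * w * diagonal H * (1 + X₂)) * S₂ +
        w * S₁ * ((1 + X₁) * w * diagonal a * Y₂) * S₂ = 0 := by
      have h0 := congrArg (fun M : Mat => w * S₁ * M * S₂) hZ'
      simp only [Matrix.mul_zero, Matrix.zero_mul] at h0
      rw [← h0]
      noncomm_ring
    -- normalise the three summands using `S₁ (1 + X₁) = 1`, `(1 + X₂) S₂ = 1`, `w w = 1`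
    have e1 : w * S₁ * (Y₁ * w * diagonal a * (1 + X₂)) * S₂ = w * (S₁ * Y₁) * w * diagonal a := by
      rw [show w * S₁ * (Y₁ * w * diagonal a * (1 + X₂)) * S₂ = w * (S₁ * Y₁) * w * diagonal a * ((1 + X₂) * S₂) by
        noncomm_ring, hS₂r, Matrix.mul_one]
    have e2 : w * S₁ * ((1 + X₁) * w * diagonal H * (1 + X₂)) * S₂ = diagonal H := by
      rw [show w * S₁ * ((1 + X₁) * w * diagonal H * (1 + X₂)) * S₂ = w * (S₁ * (1 + X₁)) * w * diagonal H * ((1 + X₂) * S₂) by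
        noncomm_ring, hS₁l, hS₂r, Matrix.mul_one, Matrix.mul_one, hww, Matrix.one_mul]
    have e3 : w * S₁ * ((1 + X₁) * w * diagonal a * Y₂) * S₂ = diagonal a * (Y₂ * S₂) := by
      rw [show w * S₁ * ((1 + X₁) * w * diagonal a * Y₂) * S₂ = w * (S₁ * (1 + X₁)) * w * diagonal a * (Y₂ * S₂) by
        noncomm_ring, hS₁l, Matrix.mul_one, hww, Matrix.one_mul]
    rw [e1, e2, e3] at h
    exact h
  -- the three summands are strictly lower, diagonal, strictly upper
  have hA : IsStrictLower (w * (S₁ * Y₁) * w * diagonal a) :=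
    (isStrictLower_weylLong_conj (upper_mul_strictUpper hY₁' hS₁up)).mul_diagonal a
  have hC : diagonal a * (Y₂ * S₂) ∈ strictUpper n R :=
    diagonal_mul_mem_strictUpper (strictUpper_mul_upper hY₂' hS₂up) a
  obtain ⟨hA0, hH0, hC0⟩ := triangular_decomp_eq_zero hA hC hrel
  -- conclude `Y₁ = 0`, `Y₂ = 0`
  have hY₁0 : Y₁ = 0 := by
    have h := congrArg (fun M : Mat => (1 + X₁) * w * M * Dinv * w) hA0
    simp only [Matrix.mul_zero, Matrix.zero_mul] at h
    rw [← h]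
    rw [show (1 + X₁) * w * (w * (S₁ * Y₁) * w * diagonal a) * Dinv * w =
        (1 + X₁) * (w * w) * S₁ * Y₁ * w * (diagonal a * Dinv) * w by noncomm_ring,
      hww, hDr, Matrix.mul_one, Matrix.mul_one, show (1 + X₁) * S₁ * Y₁ * w * w = ((1 + X₁) * S₁) * Y₁ * (w * w) by
        noncomm_ring, hS₁r, hww, Matrix.one_mul, Matrix.mul_one]
  have hY₂0 : Y₂ = 0 := by
    have h := congrArg (fun M : Mat => Dinv * M * (1 + X₂)) hC0
    simp only [Matrix.mul_zero, Matrix.zero_mul] at h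
    rw [← h]
    rw [show Dinv * (diagonal a * (Y₂ * S₂)) * (1 + X₂) = (Dinv * diagonal a) * Y₂ * (S₂ * (1 + X₂)) by noncomm_ring,
      hDl, hS₂l, Matrix.one_mul, Matrix.mul_one]
  subst hY₁0; subst hY₂0; subst hH0
  rfl

end Deriv

/-- The strictly lower part of a matrix. [folklore] -/
def lowPart (M : Mat) : Mat := fun i j => if j < i then M i j else 0

/-- The strictly upper part of a matrix. [folklore] -/
def upPart (M : Mat) : Mat := fun i j => if i < j then M i j else 0

omit [NormedAlgebra ℝ R] in
/-- `M = low M + diag M + up M`. [folklore] -/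
theorem lowPart_add_diagonal_add_upPart (M : Mat) : lowPart M + diagonal (fun i => M i i) + upPart M = M := by
  ext i j
  simp only [Matrix.add_apply, lowPart, upPart, diagonal_apply]
  rcases lt_trichotomy i j with h | h | h
  · rw [if_neg (not_lt.2 h.le), if_neg (ne_of_lt h), if_pos h]; ring
  · subst h; simp
  · rw [if_pos h, if_neg (ne_of_gt h), if_neg (not_lt.2 h.le)]; ring

omit [NormedAlgebra ℝ R] in
/-- `low M` is strictly lower. [folklore] -/
theorem isStrictLower_lowPart (M : Mat) : IsStrictLower (lowPart M) := fun i j hij => by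
  simp only [lowPart, if_neg (not_lt.2 hij)]

omit [NormedAlgebra ℝ R] in
/-- `up M` is strictly upper. [folklore] -/
theorem upPart_mem_strictUpper (M : Mat) : upPart M ∈ strictUpper n R := fun i j hij => by
  simp only [upPart, if_neg (not_lt.2 hij)]

omit [NormedAlgebra ℝ R] in
/-- `w⁰ A w⁰` is strictly upper for strictly lower `A`. [folklore] -/
theorem weylLong_conj_mem_strictUpper {A : Mat} (hA : IsStrictLower A) :
    ((weylLong n R : GL (Fin n) R) : Mat) * A * ((weylLong n R : GL (Fin n) R) : Mat) ∈ strictUpper n R :=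
  fun i j hij => by rw [weylLong_conj_apply]; exact hA _ _ (Fin.rev_le_rev.2 hij)

/-- **Surjectivity of the derivative** at a point with unit torus coordinate (explicit triangular
solution). [folklore] -/
theorem cellChartDerivFun_surjective {e : CellParam n R} (he : e ∈ cellSource n R) :
    Function.Surjective (cellChartDerivFun e) := by
  intro M
  obtain ⟨⟨X₁, hX₁⟩, a, ⟨X₂, hX₂⟩⟩ := e
  have hX₁' : X₁ ∈ strictUpper n R := hX₁
  have hX₂' : X₂ ∈ strictUpper n R := hX₂
  have ha : ∀ i, IsUnit (a i) := he
  set w : Mat := ((weylLong n R : GL (Fin n) R) : Mat) with hw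
  set S₁ : Mat := (((unitri X₁ hX₁')⁻¹ : GL (Fin n) R) : Mat) with hS₁
  set S₂ : Mat := (((unitri X₂ hX₂')⁻¹ : GL (Fin n) R) : Mat) with hS₂
  set Dinv : Mat := (((diagUnitsGL a ha)⁻¹ : GL (Fin n) R) : Mat) with hDinv
  have hS₁l : S₁ * (1 + X₁) = 1 := by
    have h := congrArg (fun g : GL (Fin n) R => (g : Mat)) (inv_mul_cancel (unitri X₁ hX₁'))
    simpa only [Units.val_mul, coe_unitri, Units.val_one] using h
  have hS₁r : (1 + X₁) * S₁ = 1 := by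
    have h := congrArg (fun g : GL (Fin n) R => (g : Mat)) (mul_inv_cancel (unitri X₁ hX₁'))
    simpa only [Units.val_mul, coe_unitri, Units.val_one] using h
  have hS₂l : S₂ * (1 + X₂) = 1 := by
    have h := congrArg (fun g : GL (Fin n) R => (g : Mat)) (inv_mul_cancel (unitri X₂ hX₂'))
    simpa only [Units.val_mul, coe_unitri, Units.val_one] using h
  have hS₂r : (1 + X₂) * S₂ = 1 := by
    have h := congrArg (fun g : GL (Fin n) R => (g : Mat)) (mul_inv_cancel (unitri X₂ hX₂'))
    simpa only [Units.val_mul, coe_unitri, Units.val_one] using h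
  have hDl : Dinv * diagonal a = 1 := by
    have h := congrArg (fun g : GL (Fin n) R => (g : Mat)) (inv_mul_cancel (diagUnitsGL a ha))
    simpa only [Units.val_mul, coe_diagUnitsGL, Units.val_one] using h
  have hDr : diagonal a * Dinv = 1 := by
    have h := congrArg (fun g : GL (Fin n) R => (g : Mat)) (mul_inv_cancel (diagUnitsGL a ha))
    simpa only [Units.val_mul, coe_diagUnitsGL, Units.val_one] using h
  have hww : w * w = 1 := weylLong_mul_weylLong
  have hS₁up : ∀ i j : Fin n, j < i → S₁ i j = 0 := fun i j hij =>
    ((mem_upperUnitriangular_iff _).1 (Subgroup.inv_mem _ (unitri_mem_upperUnitriangular X₁ hX₁'))).1 hij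
  have hX₂up : ∀ i j : Fin n, j < i → (1 + X₂) i j = 0 := fun i j hij => by
    rw [Matrix.add_apply, Matrix.one_apply, if_neg (ne_of_gt hij), hX₂' i j hij.le, add_zero]
  have hX₁up : ∀ i j : Fin n, j < i → (1 + X₁) i j = 0 := fun i j hij => by
    rw [Matrix.add_apply, Matrix.one_apply, if_neg (ne_of_gt hij), hX₁' i j hij.le, add_zero]
  have hDinvdiag : Dinv = diagonal fun i => (((ha i).unit⁻¹ : Rˣ) : R) := rfl
  -- the transformed right-hand side and its triangular parts
  set M' : Mat := w * S₁ * M * S₂ with hM'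
  set Y₁ : Mat := (1 + X₁) * (w * (lowPart M' * Dinv) * w) with hY₁
  set Y₂ : Mat := Dinv * upPart M' * (1 + X₂) with hY₂
  have hY₁m : Y₁ ∈ strictUpper n R := by
    refine upper_mul_strictUpper (weylLong_conj_mem_strictUpper ?_) hX₁up
    rw [hDinvdiag]; exact (isStrictLower_lowPart M').mul_diagonal _
  have hY₂m : Y₂ ∈ strictUpper n R := by
    refine strictUpper_mul_upper ?_ hX₂up
    rw [hDinvdiag]
    exact diagonal_mul_mem_strictUpper (upPart_mem_strictUpper M') _
  refine ⟨(⟨Y₁, hY₁m⟩, fun i => M' i i, ⟨Y₂, hY₂m⟩), ?_⟩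
  show Y₁ * w * diagonal a * (1 + X₂) + (1 + X₁) * w * diagonal (fun i => M' i i) * (1 + X₂) +
      (1 + X₁) * w * diagonal a * Y₂ = M
  -- `Ψ'(Y) = (1 + X₁) w (low + diag + up) (1 + X₂) = (1 + X₁) w M' (1 + X₂) = M`
  have h1 : Y₁ * w * diagonal a * (1 + X₂) = (1 + X₁) * w * lowPart M' * (1 + X₂) := by
    rw [hY₁]
    calc (1 + X₁) * (w * (lowPart M' * Dinv) * w) * w * diagonal a * (1 + X₂)
        = (1 + X₁) * w * lowPart M' * Dinv * (w * w) * diagonal a * (1 + X₂) := by noncomm_ring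
      _ = (1 + X₁) * w * lowPart M' * (Dinv * diagonal a) * (1 + X₂) := by rw [hww]; noncomm_ring
      _ = (1 + X₁) * w * lowPart M' * (1 + X₂) := by rw [hDl]; noncomm_ring
  have h3 : (1 + X₁) * w * diagonal a * Y₂ = (1 + X₁) * w * upPart M' * (1 + X₂) := by
    rw [hY₂, show (1 + X₁) * w * diagonal a * (Dinv * upPart M' * (1 + X₂)) =
      (1 + X₁) * w * (diagonal a * Dinv) * upPart M' * (1 + X₂) by noncomm_ring, hDr]
    noncomm_ring
  rw [h1, h3]
  have hsum := lowPart_add_diagonal_add_upPart M'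
  calc (1 + X₁) * w * lowPart M' * (1 + X₂) + (1 + X₁) * w * diagonal (fun i => M' i i) * (1 + X₂) +
        (1 + X₁) * w * upPart M' * (1 + X₂)
      = (1 + X₁) * w * (lowPart M' + diagonal (fun i => M' i i) + upPart M') * (1 + X₂) := by noncomm_ring
    _ = (1 + X₁) * w * M' * (1 + X₂) := by rw [hsum]
    _ = M := by
        rw [hM', show (1 + X₁) * w * (w * S₁ * M * S₂) * (1 + X₂) = (1 + X₁) * (w * w) * S₁ * M * (S₂ * (1 + X₂)) by
          noncomm_ring, hww, hS₂l, Matrix.mul_one, Matrix.mul_one, hS₁r, Matrix.one_mul]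

/-! ### 3. The chart is an open embedding with smooth inverse (inverse function theorem) -/

section Inverse

variable [FiniteDimensional ℝ R] {e : CellParam n R}

omit [FiniteDimensional ℝ R] in
/-- The Fréchet derivative of the chart is bijective at points with unit torus coordinate. [folklore] -/
theorem fderiv_cellChart_bijective (he : e ∈ cellSource n R) : Function.Bijective (fderiv ℝ cellChart e) := by
  have heq : ⇑(fderiv ℝ cellChart e) = cellChartDerivFun e := funext fun Y => fderiv_cellChart_apply e Y
  rw [heq]
  exact ⟨cellChartDerivFun_injective he, cellChartDerivFun_surjective he⟩

/-- **The derivative as a continuous linear isomorphism** `𝔫 × Rⁿ × 𝔫 ≃ M_n(R)` at a point with unit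
torus coordinate. [folklore] -/
def cellChartDerivEquiv (he : e ∈ cellSource n R) : CellParam n R ≃L[ℝ] Mat :=
  (LinearEquiv.ofBijective (fderiv ℝ cellChart e : CellParam n R →ₗ[ℝ] Mat)
    (fderiv_cellChart_bijective he)).toContinuousLinearEquiv

/-- The isomorphism is the derivative. [folklore] -/
@[simp] theorem coe_cellChartDerivEquiv (he : e ∈ cellSource n R) :
    (cellChartDerivEquiv he : CellParam n R →L[ℝ] Mat) = fderiv ℝ cellChart e :=
  ContinuousLinearMap.ext fun _ => rfl

/-- **Strict differentiability with invertible derivative.** [folklore] -/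
theorem hasStrictFDerivAt_cellChart (he : e ∈ cellSource n R) :
    HasStrictFDerivAt cellChart (cellChartDerivEquiv he : CellParam n R →L[ℝ] Mat) e := by
  rw [coe_cellChartDerivEquiv]
  exact contDiff_cellChart.contDiffAt.hasStrictFDerivAt (by simp)

omit [FiniteDimensional ℝ R] in
/-- **The chart is injective on `cellSource`** (uniqueness of the Bruhat decomposition,
`bigCellMap_injective`). [folklore] -/
theorem injOn_cellChart : InjOn (cellChart : CellParam n R → Mat) (cellSource n R) := by
  rintro ⟨⟨X₁, hX₁⟩, a, ⟨X₂, hX₂⟩⟩ he ⟨⟨X₁', hX₁'⟩, a', ⟨X₂', hX₂'⟩⟩ he' h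
  obtain ⟨h1, h2, h3⟩ := bigCellMap_injective (hX₁ : X₁ ∈ strictUpper n R) hX₁' (hX₂ : X₂ ∈ strictUpper n R) hX₂'
    (he : ∀ i, IsUnit (a i)) he' h
  subst h1; subst h2; subst h3; rfl

/-- The chart maps neighbourhoods onto neighbourhoods at points of `cellSource`. [folklore] -/
theorem map_nhds_cellChart_eq (he : e ∈ cellSource n R) : map cellChart (𝓝 e) = 𝓝 (cellChart e) :=
  (hasStrictFDerivAt_cellChart he).map_nhds_eq_of_equiv

/-- The restriction of the chart to `cellSource` is an open map. [folklore] -/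
theorem isOpenMap_restrict_cellChart : IsOpenMap ((cellSource n R).restrict (cellChart : CellParam n R → Mat)) := by
  rw [isOpenMap_iff_nhds_le]
  rintro ⟨x, hx⟩
  rw [restrict_apply, restrict_eq, ← Filter.map_map, map_nhds_subtype_val, isOpen_cellSource.nhdsWithin_eq hx,
    map_nhds_cellChart_eq hx]

variable (n R) in
/-- **The chart as an open partial homeomorphism** `𝔫 × Rⁿ × 𝔫 ⊃ cellSource ≅ bigCell ⊂ M_n(R)`.
[folklore] -/
def cellChartHomeo : OpenPartialHomeomorph (CellParam n R) Mat :=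
  OpenPartialHomeomorph.ofContinuousOpenRestrict (injOn_cellChart.toPartialEquiv cellChart (cellSource n R))
    contDiff_cellChart.continuous.continuousOn isOpenMap_restrict_cellChart isOpen_cellSource

/-- The forward map of `cellChartHomeo` is the chart. [folklore] -/
@[simp] theorem cellChartHomeo_apply (x : CellParam n R) : cellChartHomeo n R x = cellChart x := rfl

/-- The source of `cellChartHomeo` is `cellSource`. [folklore] -/
@[simp] theorem cellChartHomeo_source : (cellChartHomeo n R).source = cellSource n R := rfl

variable (n R) in
/-- **The big cell** `Ω = Ψ(cellSource) = N w⁰ A N ⊂ M_n(R)` (inside `GL_n(R)`). [folklore] -/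
def bruhatBigCell : Set (Matrix (Fin n) (Fin n) R) := (cellChartHomeo n R).target

/-- The big cell is the image of `cellSource` under the chart. [folklore] -/
theorem bruhatBigCell_eq_image : bruhatBigCell n R = cellChart '' cellSource n R := rfl

/-- **The big cell is open.** [folklore] -/
theorem isOpen_bruhatBigCell : IsOpen (bruhatBigCell n R) := (cellChartHomeo n R).open_target

/-- **The inverse of the chart is smooth on the big cell.** [folklore] -/
theorem contDiffAt_cellChartHomeo_symm {g : Mat} (hg : g ∈ bruhatBigCell n R) :
    ContDiffAt ℝ ∞ (cellChartHomeo n R).symm g := by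
  have hsrc : (cellChartHomeo n R).symm g ∈ cellSource n R := (cellChartHomeo n R).map_target hg
  exact (cellChartHomeo n R).contDiffAt_symm hg (hasStrictFDerivAt_cellChart hsrc).hasFDerivAt
    contDiff_cellChart.contDiffAt

/-- The inverse of the chart is smooth on the big cell (`ContDiffOn` form). [folklore] -/
theorem contDiffOn_cellChartHomeo_symm : ContDiffOn ℝ ∞ (cellChartHomeo n R).symm (bruhatBigCell n R) :=
  fun _ hg => (contDiffAt_cellChartHomeo_symm hg).contDiffWithinAt

/-- `Ψ(Ψ⁻¹ g) = g` on the big cell. [folklore] -/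
theorem cellChart_symm_apply {g : Mat} (hg : g ∈ bruhatBigCell n R) : cellChart ((cellChartHomeo n R).symm g) = g :=
  (cellChartHomeo n R).right_inv hg

/-- `Ψ⁻¹(Ψ x) = x` on `cellSource`. [folklore] -/
theorem symm_cellChart_apply {x : CellParam n R} (hx : x ∈ cellSource n R) : (cellChartHomeo n R).symm (cellChart x) = x :=
  (cellChartHomeo n R).left_inv hx

/-- Points of the big cell have unit torus coordinate. [folklore] -/
theorem symm_mem_cellSource {g : Mat} (hg : g ∈ bruhatBigCell n R) : (cellChartHomeo n R).symm g ∈ cellSource n R :=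
  (cellChartHomeo n R).map_target hg

end Inverse
end Literature.NumberTheory.Automorphic
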